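import Summits.CriticalPhenomena.PercolationContinuityZ3.Theorems.PercNearOneGluingNoHeavyLowerTailSahiSlotCell34Check

/-!
# The cell `(3,4)` in the kernel, II: FACTS about the checker's tables and the SPECIFICATION of its state

Support file of the one-cut programme (crux `NoHeavyLowerTail`, stmt-CriticalPhenomena-4575; cell `prim-masterthm`, seat P3, gen 19;
`run/shared/lean/prim/prim-masterthm/prim-masterthm-p3/HIERARCHY.md` §27).  Companion of `…SahiSlotCell34Check` (the checker) on the way to
`SlotPatternPos 3 4`.

* FACTS (finite, by evaluation — `native_decide` on Boolean checks — or by unfolding `Array.ofFn`): the cells of the 576 transversals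
  (`transCell_lt`, `transCell_div`), soundness / completeness / distinctness of the incidence table `mkCtx.ty` (`ty_sound`, `ty_complete`,
  `ty_nodup`), the down-set tables (`dc_getD`, `dm_getD`, `testBit_downMask`), the table of `Ψ` (`psiTab_getD`: the fast multilinear evaluation
  `psi psiT` agrees with the specification `psiSlow` on all `2^16` patterns) and of its increments (`ct_getD`).  The field projections of the
  table record are stated with variables (`Ctx.ct_mk` …) so that no definitional unfolding of a table is ever asked of the kernel.
* SPECIFICATION: a family is a vector of four DOWN-MASKS `d : Fin 4 → ℕ` (member `i` = cells outside `d i`); `patOf d L` is the 16-bit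
  incidence pattern of the transversal `L`, `phiRef d = Σ_{L<576} Ψ(patOf d L)` the functional the search maintains (`= sStarN 4 3`, file
  `…Cell34Ident`); `PInv` is the loop invariant; `addCell` / `testBit_patOf_addCell` / `patOf_addCell_of_mem` / `_of_not_mem` say how ONE
  removed cell moves the patterns (only the bit `(i, position)` of the transversals through it).
HONEST LABEL: bookkeeping lemmas; no claim about `(3,4)` here. [this work]
-/

namespace Summit.CriticalPhenomena.PercolationContinuityZ3.Theorems

namespace SahiSlot34

/-! ## II. FACTS about the tables and the SPECIFICATION of the search state -/

section Facts

open Finset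

/-! ### Small helpers -/

/-- `getD` of `Array.ofFn` inside the range. [this work] -/
theorem getD_ofFn {α : Type*} {n : ℕ} (f : Fin n → α) (i : ℕ) (h : i < n) (dflt : α) :
    (Array.ofFn f).getD i dflt = f ⟨i, h⟩ := by
  rw [Array.getD_eq_getD_getElem?, Array.getElem?_ofFn]
  simp [h]

/-- Bits of `m − 2^b` when bit `b` of `m` is set: bit `b` is cleared, the others are unchanged. [this work] -/
theorem testBit_sub_two_pow {m b : ℕ} (hb : m.testBit b = true) (j : ℕ) :
    (m - 2 ^ b).testBit j = (m.testBit j && !decide (j = b)) := by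
  -- `m = 2^(b+1) h + r`, `r = 2^b + lo`, `lo < 2^b`
  set h := m / 2 ^ (b + 1) with hh
  set r := m % 2 ^ (b + 1) with hr
  have hm : m = 2 ^ (b + 1) * h + r := by rw [hh, hr]; exact (Nat.div_add_mod m (2 ^ (b + 1))).symm
  have hrlt : r < 2 ^ (b + 1) := Nat.mod_lt _ (by positivity)
  have hrb : r.testBit b = true := by
    have := Nat.testBit_two_pow_mul_add h hrlt b
    rw [← hm] at this
    rw [← hb, this]
    simp
  have hrge : 2 ^ b ≤ r := Nat.ge_two_pow_of_testBit hrb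
  set lo := r - 2 ^ b with hlo
  have hr2 : r = 2 ^ b + lo := by omega
  have hlolt : lo < 2 ^ b := by
    have : 2 ^ (b + 1) = 2 * 2 ^ b := by rw [pow_succ]; ring
    omega
  have hlolt' : lo < 2 ^ (b + 1) := lt_of_lt_of_le hlolt (Nat.pow_le_pow_right (by norm_num) (by omega))
  have hsub : m - 2 ^ b = 2 ^ (b + 1) * h + lo := by omega
  rw [hsub, Nat.testBit_two_pow_mul_add h hlolt' j, hm, Nat.testBit_two_pow_mul_add h hrlt j]
  by_cases hj : j < b + 1
  · simp only [hj, ite_true]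
    rcases Nat.lt_succ_iff_lt_or_eq.1 hj with hjb | hjb
    · rw [hr2, Nat.testBit_two_pow_add_gt hjb]
      simp [Nat.ne_of_lt hjb]
    · subst hjb
      rw [Nat.testBit_lt_two_pow hlolt]
      simp
  · simp only [hj, ite_false]
    have : j ≠ b := by omega
    simp [this]

/-- Coordinates of a cell code are `< 4`, `cx` when the code is `< 64`. [this work] -/
theorem cx_lt {c : ℕ} (hc : c < 64) : cx c < 4 := by unfold cx; omega
/-- [this work] -/
theorem cy_lt (c : ℕ) : cy c < 4 := by unfold cy; omega
/-- [this work] -/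
theorem cz_lt (c : ℕ) : cz c < 4 := by unfold cz; omega

/-! ### The transversal tables -/

/-- Finite check: the cells of the transversals are cells of the cube, cell `j` has `x`-coordinate `j`. [this work] -/
theorem transCell_check :
    ((List.range 576).all fun L => (List.range 4).all fun j => decide (transCell L j < 64) && decide (transCell L j / 16 = j)) = true := by
  native_decide
/-- Every cell of a transversal is a cell of the cube. [this work] -/
theorem transCell_lt (L : Fin 576) (j : Fin 4) : transCell L j < 64 := by
  have h := transCell_check
  simp only [List.all_eq_true, List.mem_range, Bool.and_eq_true, decide_eq_true_eq] at h
  exact (h L L.isLt j j.isLt).1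
/-- Cell `j` of a transversal has `x`-coordinate `j` (so the four cells are distinct). [this work] -/
theorem transCell_div (L : Fin 576) (j : Fin 4) : transCell L j / 16 = j.val := by
  have h := transCell_check
  simp only [List.all_eq_true, List.mem_range, Bool.and_eq_true, decide_eq_true_eq] at h
  exact (h L L.isLt j j.isLt).2

/-- Field projections of a table record (stated with variables, so that no table is ever unfolded by a definitional check). [this work] -/
theorem Ctx.ty_mk (a : Array (List ℕ)) (b : Array ℤ) (c : Array (List ℕ)) (e : Array ℕ) : (Ctx.mk a b c e).ty = a := rfl
/-- [this work] -/
theorem Ctx.ct_mk (a : Array (List ℕ)) (b : Array ℤ) (c : Array (List ℕ)) (e : Array ℕ) : (Ctx.mk a b c e).ct = b := rfl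
/-- [this work] -/
theorem Ctx.dc_mk (a : Array (List ℕ)) (b : Array ℤ) (c : Array (List ℕ)) (e : Array ℕ) : (Ctx.mk a b c e).dc = c := rfl
/-- [this work] -/
theorem Ctx.dm_mk (a : Array (List ℕ)) (b : Array ℤ) (c : Array (List ℕ)) (e : Array ℕ) : (Ctx.mk a b c e).dm = e := rfl

/-- The `ty` field of `mkCtx`. [this work] -/
theorem mkCtx_ty : mkCtx.ty = Array.ofFn (n := 256) fun t => (tyList (t.val / 4)).map fun e => 16 * (e / 4) + (4 * (t.val % 4) + e % 4) := by
  unfold mkCtx; exact Ctx.ty_mk _ _ _ _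
/-- The `ct` field of `mkCtx`. [this work] -/
theorem mkCtx_ct : mkCtx.ct = ctTab := by
  unfold mkCtx; exact Ctx.ct_mk _ _ _ _
/-- The `dc` field of `mkCtx`. [this work] -/
theorem mkCtx_dc : mkCtx.dc = Array.ofFn (n := 64) fun p => downCells p.val := by
  unfold mkCtx; exact Ctx.dc_mk _ _ _ _
/-- The `dm` field of `mkCtx`. [this work] -/
theorem mkCtx_dm : mkCtx.dm = Array.ofFn (n := 64) fun p => downMask p.val := by
  unfold mkCtx; exact Ctx.dm_mk _ _ _ _

/-- Membership in `tyList`. [this work] -/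
theorem mem_tyList {y e : ℕ} : e ∈ tyList y ↔ e < 2304 ∧ transCell (e / 4) (e % 4) = y := by
  unfold tyList; simp [List.mem_filter, List.mem_range]

/-- The table `ty` of `mkCtx`. [this work] -/
theorem ty_getD {y i : ℕ} (hy : y < 64) (hi : i < 4) :
    mkCtx.ty.getD (4 * y + i) [] = (tyList y).map fun e => 16 * (e / 4) + (4 * i + e % 4) := by
  rw [mkCtx_ty, getD_ofFn _ _ (by omega)]
  have h1 : (4 * y + i) / 4 = y := by omega
  have h2 : (4 * y + i) % 4 = i := by omega
  simp only [h1, h2]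

/-- SOUNDNESS of the incidence table: an update entry `e` filed under `(y, i)` names a transversal `e / 16 < 576`, a bit in row `i`, and the position
of `y` in that transversal. [this work] -/
theorem ty_sound {y i e : ℕ} (hy : y < 64) (hi : i < 4) (he : e ∈ mkCtx.ty.getD (4 * y + i) []) :
    e / 16 < 576 ∧ e % 16 = 4 * i + e % 16 % 4 ∧ transCell (e / 16) (e % 16 % 4) = y := by
  rw [ty_getD hy hi, List.mem_map] at he
  obtain ⟨e', he', rfl⟩ := he
  rw [mem_tyList] at he'
  have hmod : e' % 4 < 4 := Nat.mod_lt _ (by norm_num)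
  refine ⟨by omega, by omega, ?_⟩
  have h1 : (16 * (e' / 4) + (4 * i + e' % 4)) / 16 = e' / 4 := by omega
  have h2 : (16 * (e' / 4) + (4 * i + e' % 4)) % 16 % 4 = e' % 4 := by omega
  rw [h1, h2]; exact he'.2

/-- COMPLETENESS of the incidence table: every (transversal, position, member) triple is filed under its cell. [this work] -/
theorem ty_complete {L j i : ℕ} (hL : L < 576) (hj : j < 4) (hi : i < 4) :
    16 * L + (4 * i + j) ∈ mkCtx.ty.getD (4 * transCell L j + i) [] := by
  have hy : transCell L j < 64 := transCell_lt ⟨L, hL⟩ ⟨j, hj⟩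
  rw [ty_getD hy hi, List.mem_map]
  refine ⟨4 * L + j, ?_, ?_⟩
  · rw [mem_tyList]
    have h1 : (4 * L + j) / 4 = L := by omega
    have h2 : (4 * L + j) % 4 = j := by omega
    exact ⟨by omega, by rw [h1, h2]⟩
  · have h1 : (4 * L + j) / 4 = L := by omega
    have h2 : (4 * L + j) % 4 = j := by omega
    rw [h1, h2]

/-- The update entries of one cell name pairwise distinct transversals. [this work] -/
theorem ty_nodup {y i : ℕ} (hy : y < 64) (hi : i < 4) : ((mkCtx.ty.getD (4 * y + i) []).map (· / 16)).Nodup := by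
  rw [ty_getD hy hi, List.map_map]
  have hnd : (tyList y).Nodup := by unfold tyList; exact (List.nodup_range).filter _
  refine hnd.map_on ?_
  intro e he e' he' heq
  rw [mem_tyList] at he he'
  simp only [Function.comp] at heq
  have h1 : (16 * (e / 4) + (4 * i + e % 4)) / 16 = e / 4 := by omega
  have h2 : (16 * (e' / 4) + (4 * i + e' % 4)) / 16 = e' / 4 := by omega
  rw [h1, h2] at heq
  -- same transversal, both positions hold `y`: equal positions
  have hpos : e % 4 = e' % 4 := by
    have hd := transCell_div ⟨e / 4, by omega⟩ ⟨e % 4, Nat.mod_lt _ (by norm_num)⟩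
    have hd' := transCell_div ⟨e' / 4, by omega⟩ ⟨e' % 4, Nat.mod_lt _ (by norm_num)⟩
    simp only at hd hd'
    have := he.2.trans he'.2.symm
    rw [heq] at this hd
    omega
  omega

/-! ### The down-set tables -/

/-- The table `dc` of `mkCtx`. [this work] -/
theorem dc_getD {p : ℕ} (hp : p < 64) : mkCtx.dc.getD p [] = downCells p := by
  rw [mkCtx_dc, getD_ofFn _ _ hp]
/-- Membership in `downCells`. [this work] -/
theorem mem_downCells {p y : ℕ} : y ∈ downCells p ↔ y < 64 ∧ cle y p = true := by
  unfold downCells; simp [List.mem_filter, List.mem_range]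
/-- `downCells` has no duplicates. [this work] -/
theorem nodup_downCells (p : ℕ) : (downCells p).Nodup := by unfold downCells; exact (List.nodup_range).filter _
/-- The table `dm` of `mkCtx`. [this work] -/
theorem dm_getD {p : ℕ} (hp : p < 64) : mkCtx.dm.getD p 0 = downMask p := by
  rw [mkCtx_dm, getD_ofFn _ _ hp]
/-- Bits of `downMask`. [this work] -/
theorem testBit_downMask (p c : ℕ) : (downMask p).testBit c = (decide (c < 64) && cle c p) := by
  unfold downMask; rw [testBit_ofBits]

/-! ### The table of `Ψ` and of its increments -/

/-- Finite check: the fast multilinear evaluation of `Ψ` agrees with the specification on every 16-bit pattern. [this work] -/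
theorem psi_check : (let T := psiT; (List.range 65536).all fun m => psi T m == psiSlow m) = true := by native_decide
/-- `psi psiT = psiSlow` on 16-bit patterns. [this work] -/
theorem psi_eq_psiSlow (m : Fin 65536) : psi psiT m.val = psiSlow m.val := by
  have h := psi_check
  simp only [List.all_eq_true, List.mem_range, beq_iff_eq] at h
  exact h m m.isLt

/-- The table `psiTab` (zeta-reduced form). [this work] -/
theorem psiTab_eq : psiTab = Array.ofFn (n := 65536) fun m => psi psiT m.val := rfl

/-- The table `psiTab`. [this work] -/
theorem psiTab_getD {m : ℕ} (hm : m < 65536) : psiTab.getD m 0 = psiSlow m := by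
  rw [psiTab_eq, getD_ofFn _ _ hm]
  exact psi_eq_psiSlow ⟨m, hm⟩

/-- The table `ctTab` (zeta-reduced form). [this work] -/
theorem ctTab_eq : ctTab = Array.ofFn (n := 65536 * 16) fun e =>
    if (e.val / 16).testBit (e.val % 16) then psiTab.getD (e.val / 16) 0 - psiTab.getD (e.val / 16 - 2 ^ (e.val % 16)) 0 else 0 := rfl

/-- Entries of `ctTab`. [this work] -/
theorem ctTab_getD {m b : ℕ} (hm : m < 65536) (hb : b < 16) :
    ctTab.getD (m * 16 + b) 0 = if m.testBit b then psiTab.getD m 0 - psiTab.getD (m - 2 ^ b) 0 else 0 := by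
  rw [ctTab_eq, getD_ofFn _ _ (by omega)]
  have h1 : (m * 16 + b) / 16 = m := by omega
  have h2 : (m * 16 + b) % 16 = b := by omega
  simp only [h1, h2]

/-- The increment table `ct` of `mkCtx`: `Ψ(m) − Ψ(m − 2^b)` at a set bit. [this work] -/
theorem ct_getD {m b : ℕ} (hm : m < 65536) (hb : b < 16) (hbit : m.testBit b = true) :
    mkCtx.ct.getD (m * 16 + b) 0 = psiSlow m - psiSlow (m - 2 ^ b) := by
  rw [mkCtx_ct, ctTab_getD hm hb, if_pos hbit, psiTab_getD hm, psiTab_getD (lt_of_le_of_lt (Nat.sub_le _ _) hm)]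

end Facts

/-! ## III. The specification: patterns and `Φ` of a family of down-masks; the loop invariants -/

section Spec

open Finset

/-- The incidence pattern of the transversal `L` for the family with down-masks `d`: bit `4i + j` = `[cell j of L ∉ ↓N_i]`. [this work] -/
def patOf (d : Fin 4 → ℕ) (L : ℕ) : ℕ :=
  ofBits (fun b => !(d ⟨b / 4 % 4, Nat.mod_lt _ (by norm_num)⟩).testBit (transCell L (b % 4))) 16

/-- `patOf d L < 2^16`. [this work] -/
theorem patOf_lt (d : Fin 4 → ℕ) (L : ℕ) : patOf d L < 65536 := ofBits_lt _ 16

/-- Bits of `patOf`. [this work] -/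
theorem testBit_patOf (d : Fin 4 → ℕ) (L b : ℕ) :
    (patOf d L).testBit b = (decide (b < 16) && !(d ⟨b / 4 % 4, Nat.mod_lt _ (by norm_num)⟩).testBit (transCell L (b % 4))) := by
  unfold patOf; rw [testBit_ofBits]

/-- `Φ` of the family with down-masks `d`, in the transversal form `Σ_L Ψ(M_L)` (the specification the search maintains;
`= sStarN 4 3`, companion file). [this work] -/
def phiRef (d : Fin 4 → ℕ) : ℤ := ∑ L ∈ range 576, psiSlow (patOf d L)

/-- The loop invariant: the pattern vector and `Φ` are those of the family `d`. [this work] -/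
structure PInv (d : Fin 4 → ℕ) (pats : Vector ℕ 576) (phi : ℤ) : Prop where
  /-- patterns -/
  pats_eq : ∀ (L : ℕ) (h : L < 576), pats[L] = patOf d L
  /-- the functional -/
  phi_eq : phi = phiRef d

/-- Adding the cell `y` to the down-mask of member `i`. [this work] -/
def addCell (d : Fin 4 → ℕ) (i : Fin 4) (y : ℕ) : Fin 4 → ℕ := Function.update d i (d i ||| 2 ^ y)

/-- Patterns after adding a cell: in a transversal through `y` the bit `(i, position of y)` is cleared, nothing else moves. [this work] -/
theorem testBit_patOf_addCell (d : Fin 4 → ℕ) (i : Fin 4) (y L b : ℕ) :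
    (patOf (addCell d i y) L).testBit b =
      ((patOf d L).testBit b && !(decide (b < 16) && decide (b / 4 % 4 = i.val) && decide (transCell L (b % 4) = y))) := by
  rw [testBit_patOf, testBit_patOf]
  by_cases hb : b < 16
  · simp only [hb, decide_true, Bool.true_and]
    by_cases hrow : b / 4 % 4 = i.val
    · have hfi : (⟨b / 4 % 4, Nat.mod_lt _ (by norm_num)⟩ : Fin 4) = i := Fin.ext hrow
      rw [hfi]
      simp only [addCell, Function.update_self, Nat.testBit_lor, Nat.testBit_two_pow, hrow, decide_true, Bool.true_and]
      by_cases hc : transCell L (b % 4) = y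
      · simp [hc]
      · have : ¬ (y = transCell L (b % 4)) := fun h => hc h.symm
        simp [hc, this]
    · have hfi : (⟨b / 4 % 4, Nat.mod_lt _ (by norm_num)⟩ : Fin 4) ≠ i := fun h => hrow (by rw [← h])
      simp only [addCell, Function.update_of_ne hfi, hrow, decide_false, Bool.false_and, Bool.not_false,
        Bool.and_true]
  · simp [hb]

/-- A transversal NOT through `y` keeps its pattern. [this work] -/
theorem patOf_addCell_of_not_mem (d : Fin 4 → ℕ) (i : Fin 4) {y L : ℕ} (hy : ∀ j < 4, transCell L j ≠ y) :
    patOf (addCell d i y) L = patOf d L := by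
  apply Nat.eq_of_testBit_eq
  intro b
  rw [testBit_patOf_addCell]
  by_cases hb : b < 16
  · have : transCell L (b % 4) ≠ y := hy _ (Nat.mod_lt _ (by norm_num))
    simp [this]
  · simp [hb]

/-- A transversal through `y` at position `j` loses exactly the bit `4i + j` (which was set when `y ∉ ↓N_i`). [this work] -/
theorem patOf_addCell_of_mem (d : Fin 4 → ℕ) (i : Fin 4) {y L j : ℕ} (hL : L < 576) (hj : j < 4) (hLj : transCell L j = y)
    (hyd : (d i).testBit y = false) :
    patOf (addCell d i y) L = patOf d L - 2 ^ (4 * i.val + j) := by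
  have hset : (patOf d L).testBit (4 * i.val + j) = true := by
    rw [testBit_patOf]
    have h1 : 4 * i.val + j < 16 := by omega
    have h2 : (4 * i.val + j) / 4 % 4 = i.val := by omega
    have h3 : (4 * i.val + j) % 4 = j := by omega
    have hfi : (⟨(4 * i.val + j) / 4 % 4, Nat.mod_lt _ (by norm_num)⟩ : Fin 4) = i := Fin.ext h2
    simp only [h1, decide_true, Bool.true_and, hfi, h3, hLj, hyd, Bool.not_false]
  apply Nat.eq_of_testBit_eq
  intro b
  rw [testBit_patOf_addCell, testBit_sub_two_pow hset]
  by_cases hb : b < 16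
  · simp only [hb, decide_true, Bool.true_and]
    by_cases hbe : b = 4 * i.val + j
    · subst hbe
      have h2 : (4 * i.val + j) / 4 % 4 = i.val := by omega
      have h3 : (4 * i.val + j) % 4 = j := by omega
      simp [h2, h3, hLj]
    · -- a different bit of the same transversal pattern: if in row `i`, its cell is not `y` (distinct positions)
      simp only [hbe, decide_false, Bool.not_false, Bool.and_true]
      by_cases hrow : b / 4 % 4 = i.val
      · have hne : transCell L (b % 4) ≠ y := by
          intro h
          have hd := transCell_div ⟨L, hL⟩ ⟨b % 4, Nat.mod_lt _ (by norm_num)⟩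
          have hd' := transCell_div ⟨L, hL⟩ ⟨j, hj⟩
          simp only at hd hd'
          rw [h, ← hLj] at hd
          omega
        simp [hne]
      · simp [hrow]
  · have : b ≠ 4 * i.val + j := by omega
    simp [hb, this]

end Spec

end SahiSlot34

end Summit.CriticalPhenomena.PercolationContinuityZ3.Theorems
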